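import Summits.HodgeConjecture.HodgeConjecture.Theorems.NikulinTwinTransportSquarePairing
import Literature.AlgebraicGeometry.Surfaces.K3SurfaceProofs
import Literature.AlgebraicGeometry.Surfaces.K3MarkingProofs
import Literature.AlgebraicGeometry.Surfaces.K3MukaiLattice
import Literature.AlgebraicGeometry.HodgeTheory.LefschetzOneOneProofs

/-!
# Route NikulinTwinTransport · item `SquareHodgeOfSqrtTwo` (stmt-HodgeConjecture-13680) —
# rationality of Künneth components on the square of a marked K3 surface

Fourth file of the Künneth bookkeeping for `S ⊗ S`. For a projective K3 surface `S` with a marking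
`η : H²(S(ℂ); ℂ) ≅ Λ_ℂ` (integral classes `↔ Λ = ℤ²²`, `a ∪ b = (ηa.ηb) • p` with `p` integral;
Huybrechts, *Lectures on K3 Surfaces*, Ch. 1 Prop. 3.5) the rational classes are `η⁻¹(Λ_ℚ)`
(`isRationalClass_iff_of_marking`), and a class is rational as soon as it pairs rationally with the
dual lattice basis (`k3Form_invCol`, `isRationalClass_of_forall_k3Form_invCol`; `Λ` is unimodular,
`k3Gram_det = -1`). With the pairing formula of `…SquarePairing` this gives the rationality half of
Voisin I, Lemma 11.41 ("the Künneth components of a Hodge class are morphisms of Hodge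
structures") on the tree's carriers:

* `exists_rat_of_isRationalClass_smul_cross_top` — a rational multiple `r • (fst^* p ∪ snd^* p)` has
  `r ∈ ℚ` (`H⁸((S ⊗ S)(ℂ); ℤ) = ℤ · P₈`, `exists_isIntegralClass_generator_top`);
* `isRationalClass_act_of_normalForm`, `isRationalClass_coact_of_normalForm` — for a RATIONAL class
  `z = Σᵢ fst^* vᵢ ∪ snd^* uᵢ + t₄ • snd^* p + t₀ • fst^* p` the endomorphisms `x ↦ Σᵢ (x.uᵢ) vᵢ` and
  `x ↦ Σᵢ (x.vᵢ) uᵢ` of `H²(S(ℂ); ℂ)` preserve rational classes;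
* `isRationalClass_of_kunneth_two`, `isRationalClass_of_kunneth_six` — the components of a rational
  `fst^* a + snd^* b`, resp. `fst^* a ∪ snd^* p + fst^* p ∪ snd^* b`, are rational.

## References

* [VoisinHodgeI2002] C. Voisin, Hodge Theory and Complex Algebraic Geometry I, CUP 2002, §11.3.3
  Lemma 11.41.
* [Huybrechts2016K3] D. Huybrechts, Lectures on K3 Surfaces, CUP 2016, Ch. 1 §3.2–3.3, Prop. 3.5;
  Ch. 14 §0.3 (vi).
* [HatcherAT2002] A. Hatcher, Algebraic Topology, CUP 2002, §3.2 Thm. 3.16, §3.3 Thm. 3.30.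
-/

noncomputable section

open CategoryTheory AlgebraicGeometry MonoidalCategory CartesianMonoidalCategory
open Literature.AlgebraicGeometry.Motives Literature.AlgebraicGeometry.HodgeTheory
open Literature.AlgebraicGeometry.Surfaces
open Literature.AlgebraicTopology.SingularHomology

namespace Summit.HodgeConjecture.HodgeConjecture.Theorems.NikulinTwinTransport

/-! ### The dual lattice basis of the unimodular `Λ_{K3}` -/

/-- **`(a . G⁻¹eₖ) = aₖ`**: pairing with the `k`-th column of the inverse Gram matrix (integral, as
`det Λ_{K3} = -1`, `k3Gram_det`) reads off the `k`-th coordinate. [cite: Huybrechts2016K3, Ch. 14 §0.3 (vi)] -/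
theorem k3Form_invCol (a : K3Index → ℂ) (k : K3Index) :
    k3Form a (fun j => ((k3Gram⁻¹ j k : ℤ) : ℂ)) = a k := by
  have hG : k3Gram * k3Gram⁻¹ = 1 :=
    Matrix.mul_nonsing_inv _ (by rw [k3Gram_det]; exact isUnit_one.neg)
  have hδ : ∀ i, (∑ j, (k3Gram i j : ℂ) * ((k3Gram⁻¹ j k : ℤ) : ℂ)) = if i = k then 1 else 0 := by
    intro i
    have h := congrFun (congrFun hG i) k
    rw [Matrix.mul_apply, Matrix.one_apply] at h
    have h' := congrArg (Int.cast : ℤ → ℂ) h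
    rw [Int.cast_sum] at h'
    simp only [Int.cast_mul] at h'
    rw [h']
    split_ifs <;> simp
  unfold k3Form
  simp_rw [mul_assoc, ← Finset.mul_sum, hδ, mul_ite, mul_one, mul_zero, Finset.sum_ite_eq',
    Finset.mem_univ, if_true]

/-- `k3Form` is linear in its first argument over finite linear combinations. [folklore] -/
theorem k3Form_sum_smul_left {ι : Type*} (s : Finset ι) (c : ι → ℂ) (a : ι → K3Index → ℂ)
    (b : K3Index → ℂ) : k3Form (∑ i ∈ s, c i • a i) b = ∑ i ∈ s, c i * k3Form (a i) b := by
  simp only [← k3FormC_apply, map_sum, map_smul, LinearMap.sum_apply, LinearMap.smul_apply, smul_eq_mul]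

section Marked

variable {S : SchemeOver ℂ} (hK3 : IsK3Surface S)
  (η : complexBetti S (2 * 1) ≃ₗ[ℂ] (K3Index → ℂ)) {p : complexBetti S (2 * 2)}
  (hint : ∀ c : complexBetti S (2 * 1), IsIntegralClass c ↔ ∃ v : K3Index → ℤ, η c = fun i => (v i : ℂ))
  (hcup : ∀ a b : complexBetti S (2 * 1),
    cupProduct (rfl : 2 * 1 + 2 * 1 = 2 * 2) a b = k3Form (η a) (η b) • p)
  (hpint : IsIntegralClass p)
  (hpp : cupProduct (rfl : 2 * 2 + 2 * 2 = 2 * 4) (complexBetti.map (fst S S) (2 * 2) p)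
    (complexBetti.map (snd S S) (2 * 2) p) ≠ 0)

include hint in
/-- The dual lattice classes `η⁻¹(G⁻¹eₖ)` are integral, hence rational. [cite: Huybrechts2016K3, Ch. 1 Prop. 3.5] -/
theorem isRationalClass_invCol (k : K3Index) :
    IsRationalClass (η.symm fun j => ((k3Gram⁻¹ j k : ℤ) : ℂ)) :=
  ((hint _).2 ⟨fun j => k3Gram⁻¹ j k, η.apply_symm_apply _⟩).isRationalClass

include hK3 hint in
/-- **Rationality criterion through the marking**: a class of `H²(S(ℂ); ℂ)` pairing rationally (for
the K3 form, through `η`) with every dual lattice vector `G⁻¹eₖ` is rational (its coordinates are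
these pairings, `k3Form_invCol`; rational classes `= η⁻¹(Λ_ℚ)`, `isRationalClass_iff_of_marking`).
[cite: Huybrechts2016K3, Ch. 1 §3.3 and Prop. 3.5] -/
theorem isRationalClass_of_forall_k3Form_invCol (c : complexBetti S (2 * 1))
    (h : ∀ k, ∃ q : ℚ, k3Form (η c) (fun j => ((k3Gram⁻¹ j k : ℤ) : ℂ)) = q) : IsRationalClass c := by
  choose q hq using h
  refine (isRationalClass_iff_of_marking hK3 η hint c).2 ⟨q, funext fun k ↦ ?_⟩
  rw [← k3Form_invCol (η c) k, hq k]

include hK3 hpint hpp in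
/-- **A rational multiple `r • (fst^* p ∪ snd^* p)` has a rational coefficient**: `fst^* p ∪ snd^* p`
is a non-zero integral class, `H⁸((S ⊗ S)(ℂ); ℂ)` has an integral generator `P₈` of which every
integral class is an integer multiple (`exists_isIntegralClass_generator_top`, Hatcher Thm. 3.30),
and a rational class has an integral multiple (`IsRationalClass.exists_nsmul_isIntegralClass`).
[cite: HatcherAT2002, §3.3 Thm. 3.30] -/
theorem exists_rat_of_isRationalClass_smul_cross_top {r : ℂ}
    (hr : IsRationalClass (r • cupProduct (rfl : 2 * 2 + 2 * 2 = 2 * 4)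
      (complexBetti.map (fst S S) (2 * 2) p) (complexBetti.map (snd S S) (2 * 2) p))) :
    ∃ q : ℚ, r = q := by
  have hP : IsSmoothProjective 4 (S ⊗ S) :=
    IsSmoothProjective.tensor_holds hK3.isSmoothProjective hK3.isSmoothProjective
  set w := cupProduct (rfl : 2 * 2 + 2 * 2 = 2 * 4) (complexBetti.map (fst S S) (2 * 2) p)
    (complexBetti.map (snd S S) (2 * 2) p) with hw
  have hwint : IsIntegralClass w := (hpint.map _).cup _ (hpint.map _)
  obtain ⟨P₈, hP₈, hP₈int, hgen⟩ := exists_isIntegralClass_generator_top hP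
  obtain ⟨m₀, hm₀⟩ := hgen w hwint
  have hm₀ne : (m₀ : ℂ) ≠ 0 := by
    intro h0
    apply hpp
    rw [hm₀, ← Int.cast_smul_eq_zsmul ℂ, h0, zero_smul]
  obtain ⟨N, hN, hNint⟩ := hr.exists_nsmul_isIntegralClass hP
  obtain ⟨m, hm⟩ := hgen _ hNint
  rw [hm₀, ← Int.cast_smul_eq_zsmul ℂ, ← Int.cast_smul_eq_zsmul ℂ, smul_smul, smul_smul] at hm
  have hcoef : (N : ℂ) * r * (m₀ : ℂ) = (m : ℂ) := smul_left_injective ℂ hP₈ hm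
  have hN' : (N : ℂ) ≠ 0 := Nat.cast_ne_zero.2 hN.ne'
  refine ⟨(m : ℚ) / (N * m₀), ?_⟩
  rw [Rat.cast_div, Rat.cast_mul, Rat.cast_intCast, Rat.cast_intCast, Rat.cast_natCast, ← hcoef]
  field_simp

include hK3 hcup hpint hpp in
/-- **The Künneth coefficients of a rational class pair rationally**: for a RATIONAL
`z = Σᵢ fst^* vᵢ ∪ snd^* uᵢ + t₄ • snd^* p + t₀ • fst^* p` and rational `x, y ∈ H²(S(ℂ); ℂ)`,
`Σᵢ (vᵢ.x)(uᵢ.y) ∈ ℚ` — it is the coefficient of the rational class `z ∪ (fst^* x ∪ snd^* y)` along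
`fst^* p ∪ snd^* p` (`normalForm_cup_cross`). [cite: VoisinHodgeI2002, §11.3.3 Lemma 11.41]
[cite: HatcherAT2002, §3.2 Thm. 3.16] -/
theorem exists_rat_coeff_of_normalForm {ι : Type} [Fintype ι] {v u : ι → complexBetti S (2 * 1)}
    {t₄ t₀ : ℂ} {z : complexBetti (S ⊗ S) (2 * 2)} (hz : IsRationalClass z)
    (hzn : z = (∑ i, cupProduct (rfl : 2 * 1 + 2 * 1 = 2 * 2) (complexBetti.map (fst S S) (2 * 1) (v i))
        (complexBetti.map (snd S S) (2 * 1) (u i))) +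
      t₄ • complexBetti.map (snd S S) (2 * 2) p + t₀ • complexBetti.map (fst S S) (2 * 2) p)
    {x y : complexBetti S (2 * 1)} (hx : IsRationalClass x) (hy : IsRationalClass y) :
    ∃ q : ℚ, (∑ i, k3Form (η (v i)) (η x) * k3Form (η (u i)) (η y)) = q := by
  have hr := hz.cup (rfl : 2 * 2 + 2 * 2 = 2 * 4)
    ((hx.map (AlgPoints.mapContinuous (L := ℂ) (fst S S))).cup (rfl : 2 * 1 + 2 * 1 = 2 * 2)
      (hy.map (AlgPoints.mapContinuous (L := ℂ) (snd S S))))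
  rw [hzn] at hr
  erw [normalForm_cup_cross hK3.isSmoothProjective hcup] at hr
  exact exists_rat_of_isRationalClass_smul_cross_top hK3 hpint hpp hr

include hK3 hint hcup hpint hpp in
/-- **The endomorphism `x ↦ Σᵢ (x.uᵢ) vᵢ` read off from a RATIONAL class
`z = Σᵢ fst^* vᵢ ∪ snd^* uᵢ + t₄ • snd^* p + t₀ • fst^* p` preserves rational classes** (Voisin I,
Lemma 11.41, rationality half): its value on a rational `x` pairs rationally with the dual lattice
basis (`exists_rat_coeff_of_normalForm`), hence is rational (`isRationalClass_of_forall_k3Form_invCol`).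
[cite: VoisinHodgeI2002, §11.3.3 Lemma 11.41] -/
theorem isRationalClass_act_of_normalForm {ι : Type} [Fintype ι] {v u : ι → complexBetti S (2 * 1)}
    {t₄ t₀ : ℂ} {z : complexBetti (S ⊗ S) (2 * 2)} (hz : IsRationalClass z)
    (hzn : z = (∑ i, cupProduct (rfl : 2 * 1 + 2 * 1 = 2 * 2) (complexBetti.map (fst S S) (2 * 1) (v i))
        (complexBetti.map (snd S S) (2 * 1) (u i))) +
      t₄ • complexBetti.map (snd S S) (2 * 2) p + t₀ • complexBetti.map (fst S S) (2 * 2) p)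
    {x : complexBetti S (2 * 1)} (hx : IsRationalClass x) :
    IsRationalClass (∑ k, k3Form (η x) (η (u k)) • v k) := by
  refine isRationalClass_of_forall_k3Form_invCol hK3 η hint _ fun k ↦ ?_
  obtain ⟨q, hq⟩ := exists_rat_coeff_of_normalForm hK3 η hcup hpint hpp hz hzn
    (isRationalClass_invCol η hint k) hx
  refine ⟨q, ?_⟩
  rw [← hq, map_sum]
  simp only [map_smul]
  rw [k3Form_sum_smul_left]
  refine Finset.sum_congr rfl fun i _ ↦ ?_
  rw [LinearEquiv.apply_symm_apply, k3Form_comm (η x) (η (u i)), mul_comm]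

include hK3 hint hcup hpint hpp in
/-- **The transposed endomorphism `x ↦ Σᵢ (x.vᵢ) uᵢ` of a RATIONAL class
`z = Σᵢ fst^* vᵢ ∪ snd^* uᵢ + t₄ • snd^* p + t₀ • fst^* p` preserves rational classes.**
[cite: VoisinHodgeI2002, §11.3.3 Lemma 11.41] -/
theorem isRationalClass_coact_of_normalForm {ι : Type} [Fintype ι] {v u : ι → complexBetti S (2 * 1)}
    {t₄ t₀ : ℂ} {z : complexBetti (S ⊗ S) (2 * 2)} (hz : IsRationalClass z)
    (hzn : z = (∑ i, cupProduct (rfl : 2 * 1 + 2 * 1 = 2 * 2) (complexBetti.map (fst S S) (2 * 1) (v i))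
        (complexBetti.map (snd S S) (2 * 1) (u i))) +
      t₄ • complexBetti.map (snd S S) (2 * 2) p + t₀ • complexBetti.map (fst S S) (2 * 2) p)
    {x : complexBetti S (2 * 1)} (hx : IsRationalClass x) :
    IsRationalClass (∑ k, k3Form (η x) (η (v k)) • u k) := by
  refine isRationalClass_of_forall_k3Form_invCol hK3 η hint _ fun k ↦ ?_
  obtain ⟨q, hq⟩ := exists_rat_coeff_of_normalForm hK3 η hcup hpint hpp hz hzn hx
    (isRationalClass_invCol η hint k)
  refine ⟨q, ?_⟩
  rw [← hq, map_sum]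
  simp only [map_smul]
  rw [k3Form_sum_smul_left]
  refine Finset.sum_congr rfl fun i _ ↦ ?_
  rw [LinearEquiv.apply_symm_apply, k3Form_comm (η x) (η (v i))]

include hK3 hint hcup hpint hpp in
/-- **The components `a`, `b` of a RATIONAL class `fst^* a + snd^* b` of `H²((S ⊗ S)(ℂ); ℂ)` are
rational**: `(a.y) • (fst^* p ∪ snd^* p) = z ∪ (fst^* y ∪ snd^* p)` and
`(b.y) • (fst^* p ∪ snd^* p) = z ∪ (fst^* p ∪ snd^* y)` are rational for rational `y`.
[cite: VoisinHodgeI2002, §11.3.3 Lemma 11.41] -/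
theorem isRationalClass_of_kunneth_two {z : complexBetti (S ⊗ S) (2 * 1)} {a b : complexBetti S (2 * 1)}
    (hz : IsRationalClass z)
    (hzn : z = complexBetti.map (fst S S) (2 * 1) a + complexBetti.map (snd S S) (2 * 1) b) :
    IsRationalClass a ∧ IsRationalClass b := by
  have hS := hK3.isSmoothProjective
  have hpr : IsRationalClass p := hpint.isRationalClass
  constructor
  · refine isRationalClass_of_forall_k3Form_invCol hK3 η hint _ fun k ↦ ?_
    have hy := isRationalClass_invCol η hint k
    have hr := hz.cup (rfl : 2 * 1 + 2 * 3 = 2 * 4)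
      ((hy.map (AlgPoints.mapContinuous (L := ℂ) (fst S S))).cup (rfl : 2 * 1 + 2 * 2 = 2 * 3)
        (hpr.map (AlgPoints.mapContinuous (L := ℂ) (snd S S))))
    rw [hzn] at hr
    erw [kunnethTwo_cup_cross_top hS hcup, LinearEquiv.apply_symm_apply] at hr
    exact exists_rat_of_isRationalClass_smul_cross_top hK3 hpint hpp hr
  · refine isRationalClass_of_forall_k3Form_invCol hK3 η hint _ fun k ↦ ?_
    have hy := isRationalClass_invCol η hint k
    have hr := hz.cup (rfl : 2 * 1 + 2 * 3 = 2 * 4)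
      ((hpr.map (AlgPoints.mapContinuous (L := ℂ) (fst S S))).cup (rfl : 2 * 2 + 2 * 1 = 2 * 3)
        (hy.map (AlgPoints.mapContinuous (L := ℂ) (snd S S))))
    rw [hzn] at hr
    erw [kunnethTwo_cup_top_cross hS hcup, LinearEquiv.apply_symm_apply] at hr
    exact exists_rat_of_isRationalClass_smul_cross_top hK3 hpint hpp hr

include hK3 hint hcup hpint hpp in
/-- **The components `a`, `b` of a RATIONAL class `fst^* a ∪ snd^* p + fst^* p ∪ snd^* b` of
`H⁶((S ⊗ S)(ℂ); ℂ)` are rational** (test against `fst^* y`, `snd^* y` for rational `y`).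
[cite: VoisinHodgeI2002, §11.3.3 Lemma 11.41] -/
theorem isRationalClass_of_kunneth_six {z : complexBetti (S ⊗ S) (2 * 3)} {a b : complexBetti S (2 * 1)}
    (hz : IsRationalClass z)
    (hzn : z = cupProduct (rfl : 2 * 1 + 2 * 2 = 2 * 3) (complexBetti.map (fst S S) (2 * 1) a)
            (complexBetti.map (snd S S) (2 * 2) p) +
          cupProduct (rfl : 2 * 2 + 2 * 1 = 2 * 3) (complexBetti.map (fst S S) (2 * 2) p)
            (complexBetti.map (snd S S) (2 * 1) b)) :
    IsRationalClass a ∧ IsRationalClass b := by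
  have hS := hK3.isSmoothProjective
  constructor
  · refine isRationalClass_of_forall_k3Form_invCol hK3 η hint _ fun k ↦ ?_
    have hy := isRationalClass_invCol η hint k
    have hr := hz.cup (rfl : 2 * 3 + 2 * 1 = 2 * 4) (hy.map (AlgPoints.mapContinuous (L := ℂ) (fst S S)))
    rw [hzn] at hr
    erw [kunnethSix_cup_map_fst hS hcup, LinearEquiv.apply_symm_apply] at hr
    exact exists_rat_of_isRationalClass_smul_cross_top hK3 hpint hpp hr
  · refine isRationalClass_of_forall_k3Form_invCol hK3 η hint _ fun k ↦ ?_
    have hy := isRationalClass_invCol η hint k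
    have hr := hz.cup (rfl : 2 * 3 + 2 * 1 = 2 * 4) (hy.map (AlgPoints.mapContinuous (L := ℂ) (snd S S)))
    rw [hzn] at hr
    erw [kunnethSix_cup_map_snd hS hcup, LinearEquiv.apply_symm_apply] at hr
    exact exists_rat_of_isRationalClass_smul_cross_top hK3 hpint hpp hr

end Marked

end Summit.HodgeConjecture.HodgeConjecture.Theorems.NikulinTwinTransport

end
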